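import Summits.AnomalousDissipation.AnomalousDissipation.Theorems.MirrorVarietyTaylorGreenLoudGalerkinStatesStubDiscreteKantorovich
import Literature.Analysis.FluidPDE.TorusForceBookkeeping

/-!
# Stub `stub_scaling` of the line `stagnation-plug-froth`
# (crux stmt-AnomalousDissipation-2987, `MirrorVariety.TaylorGreenLoudGalerkinStates`)

**Exact covariance of the steady Navier–Stokes problem on `T³`** (the registered signature, verbatim):
under `(U, ν, g) ↦ (U/s, ν/s, g/s²)` the tested steady form `testedForm` scales by `1/s²`, its
linearisation `linForm` (in the direction `w`, test `a` fixed) by `1/s`, the enstrophy `gradNormSq`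
and the energy `∫ ‖U‖²` by `(1/s)²`, and `U/s` is a `K`-field whenever `U` is.

Everything is pointwise linear algebra under the integral sign:
* `convect (c • U) a x = c • convect U a x` — `convect U a x = Torus.fderiv a x (U x)` is a continuous
  linear map applied to the transporting vector (`map_smul`; no differentiability of anything needed);
* `real_inner_smul_left/right`, then `MeasureTheory.integral_const_mul` (unconditional);
* `Torus.partialDeriv_const_smul` (for the `C¹` field `U`), `norm_smul`, `sq_abs`, `Finset.mul_sum`;
* `IsSmooth.smul`, `isDivFree_const_smul`, `hasZeroMean_const_smul`, `isKSymm_smul`.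
The hypotheses `0 < s` and `IsSmooth g` of the registered signature are not needed (with Lean's
`1/0 = 0` every identity degenerates consistently at `s = 0`), but the signature is kept verbatim.

Source: folklore (dimensional analysis of steady Navier–Stokes; Temam, *Navier–Stokes Equations* (1979) Ch. II §1).
-/

-- `Summit.<Summit>.<Problem>` is the tree's mandated summit-side namespace (CONVENTIONS §2); for this
-- single-conjunct summit the two coincide, so the duplicate is deliberate.
set_option linter.dupNamespace false
noncomputable section
open scoped BigOperators Topology InnerProductSpace
open Filter MeasureTheory
open Literature.Analysis.FunctionSpaces Literature.Analysis.FunctionSpaces.Torus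
namespace Summit.AnomalousDissipation.AnomalousDissipation.Theorems.TaylorGreenLoudGalerkinStates.Scaling
open Summit.AnomalousDissipation.AnomalousDissipation.Theorems.TaylorGreenLoudGalerkinStates
open Summit.AnomalousDissipation.AnomalousDissipation.Theorems.TaylorGreenLoudGalerkinStates.Negative

/-! ## §1 Pointwise linearity of the convective term in the transporting field -/

/-- `((c • U)·∇) a = c • (U·∇) a` pointwise: `convect` is a continuous linear map applied to the
transporting vector, so no regularity is needed. [folklore] -/
theorem convect_const_smul_left (c : ℝ) (U a : UnitAddTorus (Fin 3) → EuclideanSpace ℝ (Fin 3))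
    (x : UnitAddTorus (Fin 3)) : convect (c • U) a x = c • convect U a x := by
  simp only [convect, Pi.smul_apply, map_smul]

/-! ## §2 The tested form and its linearisation -/

/-- Covariance of the tested steady form: `testedForm (ν/s) (g/s²) (U/s) a = (1/s²) · testedForm ν g U a`
(pointwise, then `integral_const_mul`). [folklore] -/
theorem testedForm_scaling (s ν : ℝ) (g U a : UnitAddTorus (Fin 3) → EuclideanSpace ℝ (Fin 3)) :
    testedForm (ν / s) ((1 / s ^ 2) • g) ((1 / s) • U) a = (1 / s ^ 2) * testedForm ν g U a := by
  unfold testedForm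
  rw [← integral_const_mul]
  congr 1
  funext x
  simp only [convect_const_smul_left, Pi.smul_apply, real_inner_smul_left, real_inner_smul_right]
  ring

/-- Covariance of the linearised form: `linForm (ν/s) (U/s) w a = (1/s) · linForm ν U w a`
(pointwise, then `integral_const_mul`). [folklore] -/
theorem linForm_scaling (s ν : ℝ) (U w a : UnitAddTorus (Fin 3) → EuclideanSpace ℝ (Fin 3)) :
    linForm (ν / s) ((1 / s) • U) w a = (1 / s) * linForm ν U w a := by
  unfold linForm
  rw [← integral_const_mul]
  congr 1
  funext x
  simp only [convect_const_smul_left, Pi.smul_apply, real_inner_smul_left, real_inner_smul_right]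
  ring

/-! ## §3 Enstrophy and energy -/

/-- `‖c • y‖² = c² ‖y‖²` for a real scalar. [folklore] -/
theorem norm_smul_sq (c : ℝ) (y : EuclideanSpace ℝ (Fin 3)) : ‖c • y‖ ^ 2 = c ^ 2 * ‖y‖ ^ 2 := by
  rw [norm_smul, mul_pow, Real.norm_eq_abs, sq_abs]

/-- Covariance of the enstrophy: `‖∇(c • U)‖² = c² ‖∇U‖²` for a smooth field `U`
(`partialDeriv_const_smul`, `Finset.mul_sum`, `integral_const_mul`). [folklore] -/
theorem gradNormSq_const_smul (c : ℝ) {U : UnitAddTorus (Fin 3) → EuclideanSpace ℝ (Fin 3)}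
    (hU : IsSmooth U) : gradNormSq (c • U) = c ^ 2 * gradNormSq U := by
  unfold gradNormSq
  rw [← integral_const_mul]
  congr 1
  funext x
  rw [Finset.mul_sum]
  refine Finset.sum_congr rfl fun i _ => ?_
  rw [partialDeriv_const_smul (hU.isContDiff (by simp)) c i, Pi.smul_apply, norm_smul_sq]

/-- Covariance of the energy: `∫ ‖(c • U) x‖² = c² ∫ ‖U x‖²` (`integral_const_mul`). [folklore] -/
theorem integral_norm_sq_const_smul (c : ℝ) (U : UnitAddTorus (Fin 3) → EuclideanSpace ℝ (Fin 3)) :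
    (∫ x, ‖(c • U) x‖ ^ 2) = c ^ 2 * ∫ x, ‖U x‖ ^ 2 := by
  rw [← integral_const_mul]
  congr 1
  funext x
  rw [Pi.smul_apply, norm_smul_sq]

/-! ## §4 `K`-fields are a cone (indeed a subspace) -/

/-- Real multiples of `K`-fields are `K`-fields (`IsSmooth.smul`, `isDivFree_const_smul`,
`hasZeroMean_const_smul`, `isKSymm_smul`). [folklore] -/
theorem isKField_const_smul (c : ℝ) {U : UnitAddTorus (Fin 3) → EuclideanSpace ℝ (Fin 3)}
    (hU : IsKField U) : IsKField (c • U) :=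
  ⟨hU.1.smul c,
    Literature.Analysis.FluidPDE.Torus.isDivFree_const_smul (hU.1.isContDiff (by simp)) hU.2.1 c,
    Literature.Analysis.FluidPDE.Torus.hasZeroMean_const_smul hU.2.2.1 c,
    DiscreteKantorovich.isKSymm_smul c hU.2.2.2⟩

/-! ## §5 The registered stub -/

/-- **stub_scaling** (exact covariance of the steady problem; the registered signature, verbatim).  For `s > 0`
and smooth `g`, `U`: the tested form, its linearisation, the enstrophy and the energy transform under
`(U, ν, g) ↦ (U/s, ν/s, g/s²)` by the factors `1/s²`, `1/s`, `(1/s)²`, `(1/s)²`, and `U/s` is a `K`-field when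
`U` is.  (The hypotheses `0 < s`, `IsSmooth g`, `IsSmooth a`, `IsSmooth w` are not used.) [folklore] -/
theorem stub_scaling :
    ∀ (s ν : ℝ) (g U : UnitAddTorus (Fin 3) → EuclideanSpace ℝ (Fin 3)), 0 < s → IsSmooth g → IsSmooth U →
      (∀ a, IsSmooth a → testedForm (ν / s) ((1 / s ^ 2) • g) ((1 / s) • U) a = (1 / s ^ 2) * testedForm ν g U a) ∧
      (∀ w a, IsSmooth w → IsSmooth a → linForm (ν / s) ((1 / s) • U) w a = (1 / s) * linForm ν U w a) ∧
      gradNormSq ((1 / s) • U) = (1 / s) ^ 2 * gradNormSq U ∧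
      (∫ x, ‖((1 / s) • U) x‖ ^ 2) = (1 / s) ^ 2 * ∫ x, ‖U x‖ ^ 2 ∧
      (IsKField U → IsKField ((1 / s) • U)) := by
  intro s ν g U _hs _hg hU
  exact ⟨fun a _ => testedForm_scaling s ν g U a, fun w a _ _ => linForm_scaling s ν U w a,
    gradNormSq_const_smul (1 / s) hU, integral_norm_sq_const_smul (1 / s) U, isKField_const_smul (1 / s)⟩

end Summit.AnomalousDissipation.AnomalousDissipation.Theorems.TaylorGreenLoudGalerkinStates.Scaling
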